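import Literature.NumberTheory.EllipticCurves.GreenbergVatsal2000.NonPrimitiveSelmerGroup
import Literature.NumberTheory.EllipticCurves.Tamagawa
import Literature.NumberTheory.EllipticCurves.GlobalMinimalModel
import HarnessLib

/-!
# Greenberg–Vatsal, *On the Iwasawa invariants of elliptic curves* (Invent. Math. 142 (2000)),
# §1 p. 8 (proved in §2: Prop. (2.5), proof of Prop. (2.8) p. 25, p. 26): at `μ^{alg}_E = 0` the
# NON-PRIMITIVE Selmer group `Sel^{Σ₀}_E(ℚ_∞)_p` is a DIVISIBLE group, for `Σ₀ ⊇` the bad primes, `p` odd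

HONEST FRAMING (BSD rank-`≤ 1` residual cell `b2b-bsdres`, home
`run/shared/lean/b2b/bsd-rank1-residual/`, unit `b2b-bsdres-eisenstein-p2`): the cell deletes the
COMBINATION-SHAPED residual classes of the rank-`≤ 1` BSD formula from PUBLISHED theorems only and
TYPES the construction-shaped ones; this is not "finishing BSD". This file records ONE published
statement as a named fact (`def … : Prop`, nothing asserted; D-0014/D-0026): the divisibility of
Greenberg–Vatsal's non-primitive Selmer group `Sel^{Σ₀}_E(ℚ_∞)_p`
(`GreenbergVatsal2000.nonPrimitiveSelmerInfty`, file `NonPrimitiveSelmerGroup`) when `p` is odd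
and good ordinary, `Sel_E(ℚ_∞)_p` is `Λ`-cotorsion with `μ = 0`, and `Σ₀` contains every prime of
bad reduction (and not `p`). With the sibling fact `NonPrimitiveLambdaInvariant` (GV (7)) and the
tree's Pontryagin algebra (`Summits/…/X2/NonPrimitiveSelmerTorsionCard.lean`) it yields GV's
"`λ^{alg}_{E,Σ₀} = dim_{𝔽_p}(Sel^{Σ₀}_E(ℚ_∞)_p[p])`" in the kernel, the counting step of the cell's
derivation of route G's `CongruentLambdaShift` from `E₁[p] ≅ E₂[p]`
(`Summits/…/X2/CongruentLambdaShiftDerived.lean`).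

## Citation header (read by this seat on the held text arXiv:math/9906215 =
## `paper:arxiv-math_9906215`, dvips stream decoded by the cell, `b2b-bsdres-lit/u1/gv2000_decoded.txt`;
## page numbers of the arXiv typescript)

* GV §1 p. 7–8: "Its main advantage is that if `Σ₀` is chosen to contain all primes of bad
  reduction, and if `p` is odd, then `Sel^{Σ₀}_E(ℚ_∞)_p[p]` is determined completely by the
  `G_ℚ`-module `E[p]`. … As for the `μ`-invariant, it is obvious that `μ^{alg}_E = μ^{alg}_{E,Σ₀}`.
  If `μ^{alg}_E = 0`, then, as we will explain later, it turns out that `Sel^{Σ₀}_E(ℚ_∞)_p` is a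
  divisible group if `Σ₀` is chosen as above. In particular, `Sel^{Σ₀}_E(ℚ_∞)_p ≅ (ℚ_p/ℤ_p)^{λ^{alg}_{E,Σ₀}}`,
  and therefore we find that `λ^{alg}_{E,Σ₀} = dim_{𝔽_p}(Sel^{Σ₀}_E(ℚ_∞)_p[p])`."
* GV §2 Prop. (2.5), p. 23: "Let `p` be an odd prime. Assume that `S_A(ℚ_∞)` is `Λ`-cotorsion and
  that `D` is unramified for the action of `G_{ℚ_p}`. Suppose that `Σ₀` is a subset of
  `Σ − {p, ∞}` which contains `Ram(A)`. Then `S^{Σ₀}_A(ℚ_∞)^` has no nonzero, finite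
  `Λ`-submodules."
* GV §2 p. 25 (proof of Prop. (2.8)): "Obviously, `S^{Σ₀}_A(ℚ_∞)` is `Λ`-cotorsion and has
  `μ`-invariant `0` if and only if `S^{Σ₀}_A(ℚ_∞)[π]` is finite … Assuming this is so,
  `S^{Σ₀}_A(ℚ_∞)^` would be a finitely generated `O`-module. By Proposition (2.5) its `O`-torsion
  submodule is `0`, and so `S^{Σ₀}_A(ℚ_∞)` is `O`-divisible. That is, `S^{Σ₀}_A(ℚ_∞) ≅ (F_p/O)^λ`,
  where `λ = corank_O(S^{Σ₀}_A(ℚ_∞)) ≥ 0`."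
* GV §2 p. 26: "Assume that `E` has good ordinary reduction at `p`. … Then `D = Ẽ[p^∞]` is
  unramified as a `G_{ℚ_p}`-module … `Sel_E(ℚ_∞)_p = S_A(ℚ_∞)`. The nonprimitive Selmer groups
  `Sel^{Σ₀}_E(ℚ_∞)_p` and `S^{Σ₀}_A(ℚ_∞)` also coincide … By Kato's theorem, `S_A(ℚ_∞)` is
  `Λ`-cotorsion."  (`Ram(E[p^∞]) ⊆` the primes of bad reduction: Néron–Ogg–Shafarevich,
  Silverman VII.4.1; in the tree `Summits/…/X2/GreenbergVatsalReductionDatum.unramified_outside`.)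

## The tree's vocabulary (no new definition)

`E/ℚ` globally minimal, `p` odd good ORDINARY (`W.HasGoodReductionAtPrime p`, `p ∤ W.frobeniusTrace p`),
`κ` the cyclotomic `ℤ_p`-extension with topological generator `γ`, `Σ₀ : Finset` of finite places
with `p ∉ Σ₀` and every `v ∉ Σ₀`, `v ∤ p` of good reduction (`W.HasGoodReductionAt v`, i.e.
`Σ₀ ⊇` the bad primes `≠ p`); "`Sel_E(ℚ_∞)_p` is `Λ`-cotorsion with `μ^{alg}_E = 0`" = for a (any)
Pontryagin-dual datum `D : W.SelmerDualData κ γ` with `D.X` finitely generated: `D.IsTorsion` and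
`D.mu = 0`; "divisible" = `p`-divisible inside the subgroup `nonPrimitiveSelmerInfty W κ Σ₀` of
`H¹(ℚ_∞, E[p^∞])` (a `p`-primary group, so this is divisibility).
-/

noncomputable section

open scoped Classical

open NumberField IsDedekindDomain Field WeierstrassCurve
  Literature.NumberTheory.EllipticCurves.GreenbergVatsal2000

namespace Literature.NumberTheory.EllipticCurves.GreenbergVatsal2000

/-- **Greenberg–Vatsal 2000, §1 p. 8 (← §2 Prop. (2.5), proof of Prop. (2.8) p. 25, p. 26): at
`μ^{alg}_E = 0` the non-primitive Selmer group is divisible.** "If `μ^{alg}_E = 0`, then … it turns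
out that `Sel^{Σ₀}_E(ℚ_∞)_p` is a divisible group if `Σ₀` is chosen as above [to contain all primes
of bad reduction, `p` odd]. In particular, `Sel^{Σ₀}_E(ℚ_∞)_p ≅ (ℚ_p/ℤ_p)^{λ^{alg}_{E,Σ₀}}`" (§2:
"By Proposition (2.5) its `O`-torsion submodule is `0`, and so `S^{Σ₀}_A(ℚ_∞)` is `O`-divisible",
with `Sel^{Σ₀}_E(ℚ_∞)_p = S^{Σ₀}_A(ℚ_∞)` at good ordinary `p`, p. 26). In the tree's vocabulary: for a
globally minimal elliptic `E/ℚ`, an ODD prime `p` of good ordinary reduction, the cyclotomic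
`ℤ_p`-extension `κ` with a topological generator `γ`, a finite set `Σ₀` of finite places not above
`p` such that `E` has good reduction at every finite place outside `Σ₀ ∪ {p}`, and a
Pontryagin-dual datum `D` of `Sel_{p^∞}(E/ℚ_∞)` with `D.X` finitely generated, `Λ`-torsion and
`μ(D.X) = 0`: every element of `Sel^{Σ₀}_E(ℚ_∞)_p` (`nonPrimitiveSelmerInfty W κ Σ₀`) is `p` times an
element of `Sel^{Σ₀}_E(ℚ_∞)_p`.
-- TODO(general form): GV's Prop. (2.5) is the stronger "`S^{Σ₀}_A(ℚ_∞)^` has no nonzero finite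
-- `Λ`-submodule" for any `A = V_p/T_p` with `S_A` cotorsion, `D = A/C` unramified (Remark (2.7):
-- or `Hom(D[π], μ_p) = 0` and `D^{I_p}` cofree), `Σ₀ ⊇ Ram(A)`, WITHOUT `μ = 0`; only the
-- divisibility consequence at `μ = 0` for `A = E[p^∞]`, good ordinary odd `p`, is transcribed.
[cite: GreenbergVatsal2000, §1 p. 8; §2 Prop. (2.5) (p. 23), proof of Prop. (2.8) (p. 25), p. 26] -/
def divisible_nonPrimitiveSelmerInfty_of_mu_eq_zero : Prop :=
  ∀ (W : WeierstrassCurve ℚ) [W.IsElliptic] [W.IsGloballyMinimal] (p : ℕ) [Fact p.Prime]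
    (_hp : p ≠ 2) (_hgood : W.HasGoodReductionAtPrime p) (_hord : ¬ (p : ℤ) ∣ W.frobeniusTrace p)
    (κ : ZpExtension ℚ p) (_hκ : κ.IsCyclotomic) (γ : absoluteGaloisGroup ℚ)
    (_hγ : κ.IsTopGenerator γ) (S₀ : Finset (HeightOneSpectrum (𝓞 ℚ)))
    (_hS₀ : ∀ v ∈ S₀, ((p : ℕ) : 𝓞 ℚ) ∉ v.asIdeal)
    (_hbad : ∀ v : HeightOneSpectrum (𝓞 ℚ), v ∉ S₀ → ((p : ℕ) : 𝓞 ℚ) ∉ v.asIdeal →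
      W.HasGoodReductionAt v)
    (D : W.SelmerDualData κ γ) [Module.Finite (IwasawaAlgebra p) D.X],
    D.IsTorsion → D.mu = 0 →
      ∀ s ∈ nonPrimitiveSelmerInfty W κ (↑S₀ : Set (HeightOneSpectrum (𝓞 ℚ))),
        ∃ t ∈ nonPrimitiveSelmerInfty W κ (↑S₀ : Set (HeightOneSpectrum (𝓞 ℚ))), p • t = s

end Literature.NumberTheory.EllipticCurves.GreenbergVatsal2000

end
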